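import Literature.MathematicalPhysics.QuantumFieldTheory.Balaban1983to89.HiggsAveraging

/-!
# `Balaban1983to89.HiggsAveragingCompose` — T. Bałaban, *(Higgs)₂,₃ quantum fields in a finite volume. I. A lower bound*, Commun. Math. Phys. **85** (1982) 603–626 [Balaban1982Higgs1]: Q_{k+1}(A) = Q(A)Q_k(A) — the operator content of (2.2)/(2.11) — PROVED for the concrete lattice model

statement-level skeleton of published theorems with citation tags; proofs where landed; nothing here is a claim about the Yang–Mills mass gap

PDF held: `paper:balaban1982-cmp85-higgs23-i` (journal page = PDF page + 602); pp. 608–609 [PDF 6–7] read from the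
×2 renders `…/pages/1982-cmp85-higgs23-I/…-p006-x2.png`, `…-p007-x2.png` of the cell `pub-balaban`.

CITATION HEADER — WHAT IS REPRODUCED.  A KNITTING identity (no SKELETON row of its own; it is the link between rows
B1.Eq2.1 ((2.2)), B1.Eq2.7 ((2.7)), B1.Eq2.10 ((2.11)) and B1.Eq2.14 ((2.14))) over the typer's CONCRETE carriers
`…Balaban1983to89.HiggsAveraging` (p239768/p242055: `avgQ` = Q(A) of (2.7), `avgQk` = Q_k(A) of (2.11),
`contourSum` = A(Γ_{y,x}) (2.1)/(2.3), `multiContourSum` = A(Γ^{(k)}_{y,x}) (2.2)): the composition rule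
**Q(A) Q_k(A) = Q_{k+1}(A)** (`avgQ_avgQk`).  p. 608 [PDF 6], verbatim: *"Next we will define the contours Γ^{(k)}_{y,x}
for y ∈ T^{(k)}_{L^kε}, x ∈ B^k(y). Let us denote by x_j a point of torus T^{(j)}_{L^jε}, such that x ∈ B^j(x_j). Of
course x_k = y and x_j ∈ B(x_{j+1}). We define Γ^{(k)}_{y,x} = Γ_{y,x_{k−1}} ∪ Γ_{x_{k−1},x_{k−2}} ∪ … ∪ Γ_{x_1,x},
y ∈ T^{(k)}_{L^kε}, x ∈ B^k(y). (2.2)"*; p. 609 [PDF 7]: *"(Q_k(A)f)(y) = L^{−kd} Σ_{x∈B^k(y)} U(A(Γ^{(k)}_{y,x}))f(x),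
y ∈ T^{(k)}_{L^kε}. (2.11)"* — so that, with (2.7) and U a representation of (R,+) (p. 605, `ChargeData.U_add`),
(Q(A)Q_k(A)f)(z) = L^{−d}Σ_{y∈B(z)} U(A(Γ_{z,y})) L^{−kd}Σ_{x∈B^k(y)} U(A(Γ^{(k)}_{y,x}))f(x)
= L^{−(k+1)d}Σ_{x∈B^{k+1}(z)} U(A(Γ^{(k+1)}_{z,x}))f(x) = (Q_{k+1}(A)f)(z).  This is the dictionary entry
"`w • Σ_y u_y (c y)` ↤ (Q_{k+1}(A)φ)(z) by (2.2)/(2.11)" of `B1RT.Display212`/`B1RTSemigroup.Display214` made a theorem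
for the model; the measure-theoretic half of (2.14) for the model (transport of `B1RTSemigroup.display214` along the
site equivalence T^{(k)} ≃ T^{(k+1)} × B) is NOT here.  Unit `lit-balaban-r14` (gen 2), HOME
`run/shared/lean/pub/lit-balaban/`.
-/

open scoped BigOperators

namespace Literature.MathematicalPhysics.QuantumFieldTheory.Balaban1983to89.HiggsAveragingCompose

open HiggsLattice HiggsAveraging

variable {P : Params} {N : ℕ}

/-- Block nesting (p. 608, *"x_j ∈ B(x_{j+1})"*): the (k+1)-st block point of x is the block point of its k-th block
point (definitional for `HiggsAveraging.blockIter`). [cite: Balaban1982Higgs1, (2.2) p.608] -/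
theorem blockIter_succ (k : ℕ) (x : Site P 0) : blockIter (k + 1) x = blockOf (blockIter k x) := rfl

/-- `B^{k+1}(z)` fibres over `B(z)`: x ∈ B^{k+1}(z) iff x_k ∈ B(z) ((1.18)–(1.20) with (2.2)'s block points).
[cite: Balaban1982Higgs1, (1.20) p.607] -/
theorem mem_blockK_succ (k : ℕ) (z : Site P (k + 1)) (x : Site P 0) :
    x ∈ blockK (k + 1) z ↔ blockIter k x ∈ block z := by
  rw [mem_blockK, blockIter_succ]
  simp [block]

/-- The transports compose along the concatenation (2.2): U(A(Γ_{z,x_k})) U(A(Γ^{(k)}_{x_k,x})) = U(A(Γ^{(k+1)}_{z,x})) for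
x ∈ B^{k+1}(z) (`multiContourSum_succ` + `ChargeData.U_add`; the two factors commute, both being exponentials of
multiples of q). [cite: Balaban1982Higgs1, (2.2)–(2.3) p.608] -/
theorem U_contourSum_mul_U_multiContourSum (C : ChargeData N) (A : VecField P 0) (k : ℕ) (z : Site P (k + 1))
    (x : Site P 0) (hx : x ∈ blockK (k + 1) z) :
    C.U (P.mesh 0) (contourSum A (toFinest z) (toFinest (blockIter k x))) * C.U (P.mesh 0) (multiContourSum A k x)
      = C.U (P.mesh 0) (multiContourSum A (k + 1) x) := by
  have hz : blockIter (k + 1) x = z := (mem_blockK (k + 1) z x).mp hx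
  rw [← ChargeData.U_add, multiContourSum_succ, hz, add_comm]

/-- **Q(A)Q_k(A) = Q_{k+1}(A)** for the concrete model (the operator content of (2.2) with (2.7), (2.11)): averaging the
k-th order averages over the next blocks IS the (k+1)-st order average — weights L^{−d}·L^{−kd} = L^{−(k+1)d}, blocks
B^{k+1}(z) = ⋃_{y∈B(z)} B^k(y), transports by `U_contourSum_mul_U_multiContourSum`. [cite: Balaban1982Higgs1, (2.11) p.609] -/
theorem avgQ_avgQk (C : ChargeData N) (A : VecField P 0) (k : ℕ) (f : ScalarField P 0 N) :
    avgQ C A (avgQk C A k f) = avgQk C A (k + 1) f := by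
  funext z
  rw [avgQ_apply, avgQk_apply]
  -- push U(A(Γ_{z,y})) through the inner average
  simp_rw [avgQk_apply, map_smul, map_sum]
  -- regroup the double sum over y ∈ B(z), x ∈ B^k(y) as a sum over x ∈ B^{k+1}(z)
  have hfib : ∀ F : Site P 0 → EuclideanSpace ℝ (Fin N),
      ∑ y ∈ block z, ∑ x ∈ blockK k y, F x = ∑ x ∈ blockK (k + 1) z, F x := by
    intro F
    have hmaps : ∀ x ∈ blockK (k + 1) z, blockIter k x ∈ block z :=
      fun x hx => (mem_blockK_succ k z x).mp hx
    rw [← Finset.sum_fiberwise_of_maps_to hmaps]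
    refine Finset.sum_congr rfl fun y hy => ?_
    refine Finset.sum_congr ?_ fun _ _ => rfl
    ext x
    simp only [Finset.mem_filter, mem_blockK]
    constructor
    · intro h
      refine ⟨?_, h⟩
      rw [blockIter_succ, h]
      simpa [block] using hy
    · exact fun h => h.2
  -- compose the transports pointwise, then regroup and collect the weights
  have hpt : ∀ y ∈ block z, ∀ x ∈ blockK k y,
      C.U (P.mesh 0) (contourSum A (toFinest z) (toFinest y)) (C.U (P.mesh 0) (multiContourSum A k x) (f x))
        = C.U (P.mesh 0) (multiContourSum A (k + 1) x) (f x) := by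
    intro y hy x hx
    have hyx : blockIter k x = y := (mem_blockK k y x).mp hx
    have hxz : x ∈ blockK (k + 1) z := by
      rw [mem_blockK_succ, hyx]; exact hy
    have hU := U_contourSum_mul_U_multiContourSum C A k z x hxz
    rw [hyx] at hU
    rw [← hU]
    rfl
  rw [Finset.sum_congr rfl fun y hy => by rw [Finset.smul_sum, Finset.sum_congr rfl fun x hx => by rw [hpt y hy x hx]]]
  simp_rw [← Finset.smul_sum]
  rw [hfib, smul_smul]
  congr 1
  rw [← mul_inv, ← pow_add]
  congr 2
  ring

end Literature.MathematicalPhysics.QuantumFieldTheory.Balaban1983to89.HiggsAveragingCompose
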